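import Summits.ABC.IUTFork.LDHSplitBadWitness
import Literature.IUT.LogVolume.Corollary22PrimeChoiceEffective
import Literature.IUT.LogVolume.Corollary22FullGaloisImage
import HarnessLib

/-!
# Branch C, TARGET #1: the CONE binder `hreg` / `hvol` yields [IUTchIV] Thm. 1.10's DISPLAY on the split-bad family over
# `ℚ(i)` WITH THE PRIME IN PRINT'S (P1) WINDOW — the regime where the display has content
# (abc-iut cell, R2 S-chain team, seat abc-iut-s2-p3 gen 2; by-name sequel of abc-iut-w5-d126's `LDHSplitBadWitness*` and
# abc-iut-s2-p4's `LDHSplitLocusDisplayPoint`)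

Record-only PROOF file (D-0012) of the abc-iut cell; TAKES NO SIDE on [IUTchIII] Cor. 3.12 or [IUTchIV] Thm. 1.10.
S. Mochizuki, *IUT IV* [Mochizuki2012], Cor. 2.2 (ii) proof (P1)–(P7) pp. 44–46: (P1) «`h^{1/2} ≤ l ≤ 10δ·h^{1/2}·log(2δ·h)`»,
(P2), (P3) «if `p_v = l` then `h_v < h^{1/2}`», (P5), (P6); Thm. 1.10 pp. 22–31 (the display
`(1/6)·log(q) ≤ (1 + 20·d_mod/l)·(log(𝔡) + log(𝔣)) + 20·(d*_mod·l + η_prm)`). [claim: Mochizuki2012, status: disputed] for every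
IUT quotation; the content of THIS file is classical arithmetic of `ℤ[i]` plus compositions BY NAME.

CONTEXT. abc-iut-w5-d126 (p442394/p442661/p443126/p443337/p443982) built the split-bad family `P_m = (ℚ(i), λ_m)`,
`λ_m = i2^m/(1 + i2^{m+1})`, admissible with a prime `l > max([F:ℚ]·h/log 2, 1 + 4^{m+1})` (`Cor22.condP2_of_lt`), and
composed abc-iut-s2-p4's `thm110Display_of_hreg_of_splitBadPoint`: `hreg ⟹ Cor22.Display P_m l η`. With `l > 4^{m+1} ≫ h`
the display's right side `20·(d*·l + η)` dominates `(1/6)·log(q) ≍ m` — it is content-free there. THIS FILE puts the prime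
in the (P1) window `l ≍ h^{1/2}`:

* `SplitBadWindow.ord_jInv_neg_of_mem'` — Case C of the pole analysis: a place `V ∋ 1 + i2^m` (`m ≥ 1`) is ALSO a pole of
  `j(λ_m)` (`1 − λ_m = (1 + i2^m)/(1 + i2^{m+1})` vanishes at `V`);
* `SplitBadWindow.dvd_of_natCast_mem`, **`SplitBadWindow.condP5_of_five_le`** — (P5) at `P_m` for EVERY prime `l ≥ 5` (`m ≥ 1`):
  a pole above `1 + i2^{m+1}` avoids `l` unless `l ∣ 1 + 4^{m+1}`, and then a pole above `1 + i2^m` avoids `l` (else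
  `l ∣ 4·(1 + 4^m) − (1 + 4^{m+1}) = 3`);
* `Cor22Window.exists_admissible_prime_window'` — the p-free twin of `Cor22Window.exists_admissible_prime_window` (p443605):
  for `D : CBData`, `d`, there is `H₀` such that every `P ∈ UP ∩ K_V` of degree `≤ d` with (P5) at every prime `≥ 5` and
  `h > H₀` has a prime `l ≥ 7` with (P2), (P3), (P5), (P6) and `h^{1/2} ≤ l ≤ 10δ_d·h^{1/2}·log(2δ_d·h)`
  (`Cor22.exists_prime_P1_P2_P3_point_of_five_le_sqrt` + `Cor22.condP6_of_seven_le`);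
* **`Conditional.exists_display_of_hreg_window_of`** (any model `F` of `ℚ(i)`) and **`exists_display_of_hreg_window`**
  (`F = CyclotomicField 4 ℚ`) — `hreg` VERBATIM (v4 p431657 = v6K p437297) ⟹ for every `η` with `IsEtaPrm η` there is `m₀`
  such that for all `m ≥ m₀` some prime `l ≥ 7` with (P2), (P3), (P5), (P6) at `P_m` ALL PROVED and
  `h_m^{1/2} ≤ l ≤ 10δ₂·h_m^{1/2}·log(2δ₂·h_m)`, `m + 1 ≤ h_m`, satisfies `Cor22.Display P_m l η`;
  **`exists_display_of_hvol_window`** — the same from v3's `hvol`.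

READING (for the planners; nothing asserted about print or any author). `Cor22.Display P l η` is
`(1/6)·log(q^{∤{2,l}}(λ)) ≤ (1 + 20·d_mod/l)·(log-diff + log-cond^{∤{2,l}}) + 20·(2^12·3^3·5·d_mod·l + η)`; at `P_m` with
`l ≍ h_m^{1/2}·log h_m` the last term is `o(h_m)` while `log(q) ≍ h_m ≍ m`, so the CONE binder of the line of record — ALONE,
Cor.-3.12-free on this locus (abc-iut-s2-p4: the (U)-Corollary stub is a theorem on split-bad points) — asserts an effective
abc/Szpiro-type inequality of exponent `6·(1 + 40/l)` for the explicit Gaussian family `i2^m + (1 + i2^m) = 1 + i2^{m+1}`, every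
hypothesis of Cor. 2.2 (ii) being a theorem of the tree. HONEST SCOPE: consequences of the typed binder; typed ≠ proved; no side
taken. PROOF-ONLY file: no definitions, no `Prop` facts. [cite: Mochizuki2012, IUTchIV Cor. 2.2 (ii) proof (P1)–(P7) p. 44–46]
[cite: Mochizuki2012, IUTchIV Thm. 1.10 pp. 22–31] [cite: IrelandRosen1982, Ch. 9 §7 p. 120] [cite: NeukirchANT1999, Ch. I §11]
-/

noncomputable section

namespace Summit.ABC.IUTFork

open NumberField IsDedekindDomain Finset
open Literature.IUT.HodgeTheaters Literature.IUT.LogVolume Literature.IUT.LogVolume.Cor22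
open Literature.NumberTheory.DiophantineGeometry Literature.NumberTheory.DiophantineGeometry.GenEll
open Summit.ABC.ABC.Theorems
open scoped Classical

/-! ## §1. Case C: places above `1 + i2^m` are poles of `j(λ_m)`; (P5) at every prime `l ≥ 5` -/

namespace SplitBadWindow

open SplitBadWitness

variable {F : Type} [Field F] [NumberField F] {ζ : 𝓞 F}

/-- **Case C (a pole above `1 + i2^m`).** For `m ≥ 1` and a finite place `V ∋ 1 + i2^m`: `ord_V j(λ_m) < 0`. Indeed `V` is odd
(`(1 + i2^m) − 2·i2^{m−1} = 1`) and misses `1 + i2^{m+1}` (`2(1 + i2^m) − (1 + i2^{m+1}) = 1`), so `|λ_m|_V = 1`,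
`|1 − λ_m|_V = |1 + i2^m|_V < 1`, `|λ_m² − λ_m + 1|_V = 1` (ultrametric), whence `|j(λ_m)|_V = |λ_m − 1|_V^{−2} > 1`.
[cite: NeukirchANT1999, Ch. I §11] [cite: IrelandRosen1982, Ch. 9 §7 p. 120] -/
theorem ord_jInv_neg_of_mem' (hζ : IsPrimitiveRoot ζ 4) {m : ℕ} (hm : 1 ≤ m) (V : HeightOneSpectrum (𝓞 F))
    (hγ : 1 + ζ * 2 ^ m ∈ V.asIdeal) :
    ord F V (jInv ((ζ : F) * 2 ^ m / (1 + (ζ : F) * 2 ^ (m + 1)))) < 0 := by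
  obtain ⟨m', rfl⟩ : ∃ m', m = m' + 1 := ⟨m - 1, by omega⟩
  have hV2 : (2 : 𝓞 F) ∉ V.asIdeal := two_notMem_of_mem V.isPrime.ne_top hγ
  have hβ : 1 + ζ * 2 ^ (m' + 1 + 1) ∉ V.asIdeal := fun hβ => notMem_of_mem V.isPrime.ne_top hβ hγ
  set x : F := (ζ : F) * 2 ^ (m' + 1) / (1 + (ζ : F) * 2 ^ (m' + 1 + 1)) with hx
  have hvβ : V.valuation F (1 + (ζ : F) * 2 ^ (m' + 1 + 1)) = 1 := by
    rw [← coe_one_add]; exact val_eq_one_of_notMem V _ hβ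
  have hvγ : V.valuation F (1 + (ζ : F) * 2 ^ (m' + 1)) < 1 := by
    rw [← coe_one_add]; exact (V.valuation_lt_one_iff_mem _).mpr hγ
  have hvl : V.valuation F x = 1 := by
    have := val_lam_mul hζ (m' + 1) V hV2
    rwa [hvβ, mul_one] at this
  have hv1 : V.valuation F (1 - x) < 1 := by
    have := val_one_sub_lam_mul hζ (m' + 1) V
    rw [hvβ, mul_one] at this
    rw [this]; exact hvγ
  have hvl1 : V.valuation F (x - 1) < 1 := by
    rw [← neg_sub, Valuation.map_neg]; exact hv1
  have hx1 : x - 1 ≠ 0 := sub_ne_zero.mpr (lam_ne_one hζ (m' + 1))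
  have hvl1ne : V.valuation F (x - 1) ≠ 0 := (Valuation.ne_zero_iff _).mpr hx1
  have hnum : V.valuation F (x ^ 2 - x + 1) = 1 := by
    have e : x ^ 2 - x + 1 = x * (x - 1) + 1 := by ring
    have hlt : V.valuation F (x * (x - 1)) < V.valuation F (1 : F) := by
      rw [map_mul, hvl, one_mul, map_one]; exact hvl1
    rw [e, Valuation.map_add_eq_of_lt_right _ hlt, map_one]
  have hvj : V.valuation F (jInv x) = ((V.valuation F (x - 1)) ^ 2)⁻¹ := by
    unfold jInv
    rw [map_div₀, map_mul, map_mul, map_pow, map_pow, map_pow, map_pow, val_two V hV2, hvl, hnum]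
    simp
  have hj0 : jInv x ≠ 0 := by
    intro h
    have := hvj
    rw [h, map_zero] at this
    exact (inv_ne_zero (pow_ne_zero 2 hvl1ne)) this.symm
  refine (ord_neg_iff_one_lt_valuation _ V hj0).mpr ?_
  rw [hvj, one_lt_inv₀ (pos_of_ne_zero (pow_ne_zero 2 hvl1ne))]
  exact pow_lt_one₀ zero_le hvl1 two_ne_zero

omit [NumberField F] in
/-- A proper ideal containing a prime `l ∈ ℕ` and a natural number `N` forces `l ∣ N` (Bézout: otherwise `1 ∈ V`).
[cite: IrelandRosen1982, Ch. 9 §7 p. 120] -/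
theorem dvd_of_natCast_mem {I : Ideal (𝓞 F)} (hI : I ≠ ⊤) {l N : ℕ} (hl : l.Prime) (hlI : ((l : ℕ) : 𝓞 F) ∈ I)
    (hN : ((N : ℕ) : 𝓞 F) ∈ I) : l ∣ N := by
  by_contra hnd
  apply hI
  rw [Ideal.eq_top_iff_one]
  have hcop : Nat.Coprime l N := (Nat.Prime.coprime_iff_not_dvd hl).mpr hnd
  obtain ⟨a, b, hab⟩ := Nat.isCoprime_iff_coprime.mpr hcop
  have : (1 : 𝓞 F) = a * (l : ℕ) + b * ((N : ℕ) : ℤ) := by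
    exact_mod_cast congrArg (fun z : ℤ => (z : 𝓞 F)) hab.symm
  rw [this]
  push_cast
  exact I.add_mem (I.mul_mem_left _ hlI) (I.mul_mem_left _ (by exact_mod_cast hN))

/-- **(P5) at `P_m` for EVERY prime `l ≥ 5`** (`m ≥ 1`): a place above `1 + i2^{m+1}` is a pole of `j(λ_m)` off `2`; it avoids `l`
unless `l ∣ 1 + 4^{m+1}`, in which case a place above `1 + i2^m` (a pole by Case C, off `2`) avoids `l` — else `l ∣ 1 + 4^m` too and
`l ∣ 4(1 + 4^m) − (1 + 4^{m+1}) = 3`. [cite: Mochizuki2012, IUTchIV Cor. 2.2 (ii) proof (P5) p. 46] [claim: Mochizuki2012, status: disputed] -/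
theorem condP5_of_five_le [IsCyclotomicExtension {4} ℚ F] (hζ : IsPrimitiveRoot ζ 4) {m : ℕ} (hm : 1 ≤ m) {l : ℕ}
    (hlp : l.Prime) (h5 : 5 ≤ l) :
    CondP5 (⟨F, (ζ : F) * 2 ^ m / (1 + (ζ : F) * 2 ^ (m + 1))⟩ : NFPoint) l := by
  obtain ⟨V, hV⟩ := exists_place_mem hζ m
  by_cases hl : ((l : ℕ) : 𝓞 F) ∈ V.asIdeal
  · -- `l ∣ 1 + 4^{m+1}`; use a place above `1 + i2^m`
    have hN : ((1 + 4 ^ (m + 1) : ℕ) : 𝓞 F) ∈ V.asIdeal := by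
      rw [← one_add_mul_one_sub hζ]; exact V.asIdeal.mul_mem_right _ hV
    have hdiv1 : l ∣ 1 + 4 ^ (m + 1) := dvd_of_natCast_mem V.isPrime.ne_top hlp hl hN
    obtain ⟨m', rfl⟩ : ∃ m', m = m' + 1 := ⟨m - 1, by omega⟩
    obtain ⟨V', hV'⟩ := exists_place_mem hζ m'
    refine ⟨V', ?_, ?_, ?_⟩
    · exact ord_jInv_neg_of_mem' hζ hm V' hV'
    · change ((2 : ℕ) : 𝓞 F) ∉ V'.asIdeal
      rw [Nat.cast_ofNat]
      exact two_notMem_of_mem V'.isPrime.ne_top hV'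
    · intro hl'
      have hN' : ((1 + 4 ^ (m' + 1) : ℕ) : 𝓞 F) ∈ V'.asIdeal := by
        rw [← one_add_mul_one_sub hζ]; exact V'.asIdeal.mul_mem_right _ hV'
      have hdiv2 : l ∣ 1 + 4 ^ (m' + 1) := dvd_of_natCast_mem V'.isPrime.ne_top hlp hl' hN'
      have h3 : l ∣ 3 := by
        have h4 : l ∣ 4 * (1 + 4 ^ (m' + 1)) := dvd_mul_of_dvd_right hdiv2 4
        have e : 4 * (1 + 4 ^ (m' + 1)) = (1 + 4 ^ (m' + 1 + 1)) + 3 := by ring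
        rw [e] at h4
        exact (Nat.dvd_add_right hdiv1).mp h4
      have : l ≤ 3 := Nat.le_of_dvd (by norm_num) h3
      omega
  · refine ⟨V, ?_, ?_, hl⟩
    · exact (mem_badPlaces_iff_ord_neg (⟨F, (ζ : F) * 2 ^ m / (1 + (ζ : F) * 2 ^ (m + 1))⟩ : NFPoint) V).1
        (mem_badPlaces_of_mem hζ m V hV)
    · change ((2 : ℕ) : 𝓞 F) ∉ V.asIdeal
      rw [Nat.cast_ofNat]
      exact two_notMem_of_mem V.isPrime.ne_top hV

end SplitBadWindow

/-! ## §2. Window-admissible primes from (P5)-at-every-prime -/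

namespace Cor22Window

/-- **Window-admissible primes, p-free form.** For `D : CBData` and `d` there is `H₀` (= `max(H_K(D), 64)`) such that every
`P ∈ UP ∩ K_V` of degree `≤ d` with (P5) at every prime `≥ 5` and `h = log(q^∀) > H₀` has a prime `l ≥ 7` with (P2), (P3)
(«`p_v = l ⟹ h_v < h^{1/2}`»), (P5), (P6) and the (P1) window `h^{1/2} ≤ l ≤ 10δ_d·h^{1/2}·log(2δ_d·h)`
(`Cor22.exists_prime_P1_P2_P3_point_of_five_le_sqrt` + `Cor22.condP6_of_seven_le`). [cite: Mochizuki2012, IUTchIV Cor. 2.2 (ii) proof (P1)–(P6) p. 44–46] -/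
theorem exists_admissible_prime_window' (D : CBData) (d : ℕ) :
    ∃ H₀ : ℝ, ∀ (P : NFPoint), P ∈ UP → P ∈ D.toSet → P.degree ≤ d →
      (∀ l : ℕ, l.Prime → 5 ≤ l → CondP5 P l) → H₀ < logQForall P →
      ∃ l : ℕ, l.Prime ∧ 7 ≤ l ∧ CondP2 P l ∧ CondP5 P l ∧ CondP6 P l ∧
        (∀ v ∈ badPlaces P, residueChar P.F v = l → localHeight P v < Real.sqrt (logQForall P)) ∧
        Real.sqrt (logQForall P) ≤ l ∧
        (l : ℝ) ≤ 10 * delta d * Real.sqrt (logQForall P) * Real.log (2 * delta d * logQForall P) := by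
  obtain ⟨HK, hHK⟩ := condP6_of_seven_le D
  refine ⟨max HK 64, fun P hUP hmem hdeg hP5 hH => ?_⟩
  have hHK' : HK < logQForall P := lt_of_le_of_lt (le_max_left _ _) hH
  have h64 : (64 : ℝ) < logQForall P := lt_of_le_of_lt (le_max_right _ _) hH
  have h8 : (8 : ℝ) < Real.sqrt (logQForall P) := by
    rw [show (8 : ℝ) = Real.sqrt (8 ^ 2) by rw [Real.sqrt_sq (by norm_num)]]
    exact Real.sqrt_lt_sqrt (by norm_num) (by norm_num; exact h64)
  have h5 : (5 : ℝ) ≤ Real.sqrt (logQForall P) := by linarith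
  obtain ⟨l, hlp, hP1lo, hP1hi, hP2, hP3⟩ := exists_prime_P1_P2_P3_point_of_five_le_sqrt P hdeg h5
  have hl9 : 9 ≤ l := by
    have : (8 : ℝ) < l := h8.trans_le hP1lo
    exact_mod_cast this
  have hl7 : 7 ≤ l := by omega
  have hP5' : CondP5 P l := hP5 l hlp (by omega)
  have hP6 : CondP6 P l := hHK P hmem hUP l hlp hl7 hP2 hP5' hHK'
  exact ⟨l, hlp, hl7, hP2, hP5', hP6, hP3, hP1lo, hP1hi⟩

end Cor22Window

/-! ## §3. The display of [IUTchIV] Thm. 1.10 from `hreg` / `hvol`, prime in the (P1) window -/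

namespace SplitBadWindow

open SplitBadWitness

/-- **Window-admissible primes at the split-bad family `P_m = (F, i2^m/(1 + i2^{m+1}))` (any model `F` of `ℚ(i)`).** There is `m₀`
such that every `P_m` with `m ≥ m₀` carries a prime `l ≥ 7` with (P2), (P3), (P5), (P6) — all PROVED — inside the (P1) window
`h_m^{1/2} ≤ l ≤ 10δ₂·h_m^{1/2}·log(2δ₂·h_m)`, where `m + 1 ≤ h_m = log(q^∀(λ_m))` (abc-iut-w5-d126: `P_m ∈ UP ∩ CBData.std ∅`,
`log(1 + 4^{m+1}) ≤ h_m`; §1–§2 here). [cite: Mochizuki2012, IUTchIV Cor. 2.2 (ii) proof (P1)–(P6) p. 44–46] [claim: Mochizuki2012, status: disputed] -/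
theorem exists_admissible_window_of (F : Type) [Field F] [NumberField F] [IsCyclotomicExtension {4} ℚ F]
    {ζ : 𝓞 F} (hζ : IsPrimitiveRoot ζ 4) :
    ∃ m₀ : ℕ, ∀ m : ℕ, m₀ ≤ m →
      ∃ l : ℕ, l.Prime ∧ 7 ≤ l ∧
        CondP2 (⟨F, (ζ : F) * 2 ^ m / (1 + (ζ : F) * 2 ^ (m + 1))⟩ : NFPoint) l ∧
        CondP5 (⟨F, (ζ : F) * 2 ^ m / (1 + (ζ : F) * 2 ^ (m + 1))⟩ : NFPoint) l ∧
        CondP6 (⟨F, (ζ : F) * 2 ^ m / (1 + (ζ : F) * 2 ^ (m + 1))⟩ : NFPoint) l ∧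
        (∀ v ∈ badPlaces (⟨F, (ζ : F) * 2 ^ m / (1 + (ζ : F) * 2 ^ (m + 1))⟩ : NFPoint), residueChar F v = l →
          localHeight (⟨F, (ζ : F) * 2 ^ m / (1 + (ζ : F) * 2 ^ (m + 1))⟩ : NFPoint) v <
            Real.sqrt (logQForall (⟨F, (ζ : F) * 2 ^ m / (1 + (ζ : F) * 2 ^ (m + 1))⟩ : NFPoint))) ∧
        Real.sqrt (logQForall (⟨F, (ζ : F) * 2 ^ m / (1 + (ζ : F) * 2 ^ (m + 1))⟩ : NFPoint)) ≤ l ∧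
        (l : ℝ) ≤ 10 * delta 2 * Real.sqrt (logQForall (⟨F, (ζ : F) * 2 ^ m / (1 + (ζ : F) * 2 ^ (m + 1))⟩ : NFPoint)) *
          Real.log (2 * delta 2 * logQForall (⟨F, (ζ : F) * 2 ^ m / (1 + (ζ : F) * 2 ^ (m + 1))⟩ : NFPoint)) ∧
        ((m : ℝ) + 1) ≤ logQForall (⟨F, (ζ : F) * 2 ^ m / (1 + (ζ : F) * 2 ^ (m + 1))⟩ : NFPoint) := by
  obtain ⟨H₀, hH₀⟩ := Cor22Window.exists_admissible_prime_window' (CBData.std ∅ (by simp)) 2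
  refine ⟨max 1 ⌈H₀⌉₊, fun m hm => ?_⟩
  have hm1 : 1 ≤ m := (le_max_left _ _).trans hm
  set Pm : NFPoint := ⟨F, (ζ : F) * 2 ^ m / (1 + (ζ : F) * 2 ^ (m + 1))⟩ with hPm
  have hh : ((m : ℝ) + 1) ≤ logQForall Pm := (succ_le_log m).trans (log_le_logQForall hζ m)
  have hH : H₀ < logQForall Pm := by
    have h1 : H₀ ≤ ⌈H₀⌉₊ := Nat.le_ceil _
    have h2 : ((⌈H₀⌉₊ : ℕ) : ℝ) ≤ m := by exact_mod_cast (le_max_right _ _).trans hm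
    linarith
  have hdeg : Pm.degree ≤ 2 := by
    change Module.finrank ℚ F ≤ 2
    rw [finrank_eq_two F]
  have hUP : Pm ∈ UP := mem_UP hζ m
  have hmem : Pm ∈ (CBData.std ∅ (by simp)).toSet := mem_std_empty hζ m
  have hP5 : ∀ l : ℕ, l.Prime → 5 ≤ l → CondP5 Pm l := fun l hl h5 => condP5_of_five_le hζ hm1 hl h5
  obtain ⟨l, hlp, hl7, hP2, hP5', hP6, hP3, hlo, hhi⟩ := hH₀ Pm hUP hmem hdeg hP5 hH
  exact ⟨l, hlp, hl7, hP2, hP5', hP6, hP3, hlo, hhi, hh⟩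

end SplitBadWindow

namespace Conditional

open SplitBadWitness

/-- **`hreg` ⟹ Thm. 1.10's DISPLAY on the split-bad family, PRIME IN THE (P1) WINDOW (any model of `ℚ(i)`).** Assume `hreg` VERBATIM
(v4 p431657 = v6K p437297). For every `η` with `IsEtaPrm η` there is `m₀` such that for all `m ≥ m₀` the point
`P_m = (F, i2^m/(1 + i2^{m+1})) ∈ UP ∩ K_V` (abc-iut-w5-d126) carries a prime `l ≥ 7` with (P2), (P3), (P5), (P6) PROVED,
`h_m^{1/2} ≤ l ≤ 10δ₂·h_m^{1/2}·log(2δ₂·h_m)`, `m + 1 ≤ h_m`, and `Cor22.Display P_m l η` (abc-iut-s2-p4's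
`thm110Display_of_hreg_of_splitBadPoint` at w5-d126's `sum_indicator_weight_le_half`). Nothing asserted about any point, about print,
or about any author; typed ≠ proved. [cite: Mochizuki2012, IUTchIV Cor. 2.2 (ii) proof (P1)–(P7) p. 44–46]
[cite: Mochizuki2012, IUTchIV Thm. 1.10 pp. 22–31] [claim: Mochizuki2012, status: disputed] -/
theorem exists_display_of_hreg_window_of (F : Type) [Field F] [NumberField F] [IsCyclotomicExtension {4} ℚ F]
    {ζ : 𝓞 F} (hζ : IsPrimitiveRoot ζ 4)
    (hreg : ∀ P : NFPoint, P ∈ UP → ∀ l : ℕ, l.Prime → 5 ≤ l →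
      Cor22.AdmitsCore P → Cor22.CondP2 P l → Cor22.CondP5 P l → Cor22.CondP6 P l →
      ∀ T : Cor22.ThetaVolumeDatumAt P l,
        (letI := T.instFieldF; letI := T.instNumberFieldF; letI := T.instAlgebraF; letI := T.instFieldK
         letI := T.instNumberFieldK; letI := T.instAlgebraK; letI := T.instFieldFbar; letI := T.instAlgebraFbar
         letI := T.instAlgebraKFbar; letI := T.instIsElliptic
         ¬ (∀ p ∈ T.I.supportPrimes, ∀ v w : placesOver (fieldOfModuli T.E) p,
            (Summit.ABC.IUTFork.DHData.ofInput T.I).logQloc p v = (Summit.ABC.IUTFork.DHData.ofInput T.I).logQloc p w)) →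
        T.HullEstimateOf
          (((l : ℝ) + 1) / 4 *
            ((1 + 12 * (Cor22.dmod P : ℝ) / l) * (P.logDiff + Cor22.logCondAvoid P {2, l})
              + 2 * Real.log l + 52
              + 20 / 3 * Real.log (((2 ^ 12 * 3 ^ 3 * 5 * Cor22.dmod P : ℕ) : ℝ) * (l : ℝ))
                * (Nat.primeCounting (2 ^ 12 * 3 ^ 3 * 5 * Cor22.dmod P * l) : ℝ))))
    {η : ℝ} (hη : IsEtaPrm η) :
    ∃ m₀ : ℕ, ∀ m : ℕ, m₀ ≤ m →
      ∃ l : ℕ, l.Prime ∧ 7 ≤ l ∧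
        CondP2 (⟨F, (ζ : F) * 2 ^ m / (1 + (ζ : F) * 2 ^ (m + 1))⟩ : NFPoint) l ∧
        CondP5 (⟨F, (ζ : F) * 2 ^ m / (1 + (ζ : F) * 2 ^ (m + 1))⟩ : NFPoint) l ∧
        CondP6 (⟨F, (ζ : F) * 2 ^ m / (1 + (ζ : F) * 2 ^ (m + 1))⟩ : NFPoint) l ∧
        (∀ v ∈ badPlaces (⟨F, (ζ : F) * 2 ^ m / (1 + (ζ : F) * 2 ^ (m + 1))⟩ : NFPoint), residueChar F v = l →
          localHeight (⟨F, (ζ : F) * 2 ^ m / (1 + (ζ : F) * 2 ^ (m + 1))⟩ : NFPoint) v <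
            Real.sqrt (logQForall (⟨F, (ζ : F) * 2 ^ m / (1 + (ζ : F) * 2 ^ (m + 1))⟩ : NFPoint))) ∧
        Real.sqrt (logQForall (⟨F, (ζ : F) * 2 ^ m / (1 + (ζ : F) * 2 ^ (m + 1))⟩ : NFPoint)) ≤ l ∧
        (l : ℝ) ≤ 10 * delta 2 * Real.sqrt (logQForall (⟨F, (ζ : F) * 2 ^ m / (1 + (ζ : F) * 2 ^ (m + 1))⟩ : NFPoint)) *
          Real.log (2 * delta 2 * logQForall (⟨F, (ζ : F) * 2 ^ m / (1 + (ζ : F) * 2 ^ (m + 1))⟩ : NFPoint)) ∧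
        ((m : ℝ) + 1) ≤ logQForall (⟨F, (ζ : F) * 2 ^ m / (1 + (ζ : F) * 2 ^ (m + 1))⟩ : NFPoint) ∧
        Cor22.Display (⟨F, (ζ : F) * 2 ^ m / (1 + (ζ : F) * 2 ^ (m + 1))⟩ : NFPoint) l η := by
  obtain ⟨m₀, hm₀⟩ := SplitBadWindow.exists_admissible_window_of F hζ
  refine ⟨m₀, fun m hm => ?_⟩
  obtain ⟨l, hlp, hl7, hP2, hP5, hP6, hP3, hlo, hhi, hh⟩ := hm₀ m hm
  exact ⟨l, hlp, hl7, hP2, hP5, hP6, hP3, hlo, hhi, hh,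
    thm110Display_of_hreg_of_splitBadPoint hreg hη (mem_UP hζ m) hlp (by omega) (admitsCore hζ m) hP2 hP5 hP6
      (fun p _ => sum_indicator_weight_le_half hζ m {2, l} (by simp) p)⟩

/-- **`hreg` ⟹ Thm. 1.10's display in the (P1) window, over `ℚ(i) = CyclotomicField 4 ℚ`** (absolute form): for every `η` with
`IsEtaPrm η` and every `H` there are an admissible `(P, l)` — (P2), (P3), (P5), (P6) PROVED, `P ∈ UP ∩ CBData.std ∅`, admitting a
core — with `H < log(q^∀(P))`, `log(q^∀)^{1/2} ≤ l ≤ 10δ₂·log(q^∀)^{1/2}·log(2δ₂·log(q^∀))` and `Cor22.Display P l η`. Nothing asserted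
about any point or about print; no side taken. [cite: Mochizuki2012, IUTchIV Cor. 2.2 (ii) proof (P1)–(P7) p. 44–46]
[claim: Mochizuki2012, status: disputed] -/
theorem exists_display_of_hreg_window
    (hreg : ∀ P : NFPoint, P ∈ UP → ∀ l : ℕ, l.Prime → 5 ≤ l →
      Cor22.AdmitsCore P → Cor22.CondP2 P l → Cor22.CondP5 P l → Cor22.CondP6 P l →
      ∀ T : Cor22.ThetaVolumeDatumAt P l,
        (letI := T.instFieldF; letI := T.instNumberFieldF; letI := T.instAlgebraF; letI := T.instFieldK
         letI := T.instNumberFieldK; letI := T.instAlgebraK; letI := T.instFieldFbar; letI := T.instAlgebraFbar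
         letI := T.instAlgebraKFbar; letI := T.instIsElliptic
         ¬ (∀ p ∈ T.I.supportPrimes, ∀ v w : placesOver (fieldOfModuli T.E) p,
            (Summit.ABC.IUTFork.DHData.ofInput T.I).logQloc p v = (Summit.ABC.IUTFork.DHData.ofInput T.I).logQloc p w)) →
        T.HullEstimateOf
          (((l : ℝ) + 1) / 4 *
            ((1 + 12 * (Cor22.dmod P : ℝ) / l) * (P.logDiff + Cor22.logCondAvoid P {2, l})
              + 2 * Real.log l + 52
              + 20 / 3 * Real.log (((2 ^ 12 * 3 ^ 3 * 5 * Cor22.dmod P : ℕ) : ℝ) * (l : ℝ))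
                * (Nat.primeCounting (2 ^ 12 * 3 ^ 3 * 5 * Cor22.dmod P * l) : ℝ))))
    {η : ℝ} (hη : IsEtaPrm η) (H : ℝ) :
    ∃ (P : NFPoint) (l : ℕ), P ∈ UP ∧ P ∈ (CBData.std ∅ (by simp)).toSet ∧ l.Prime ∧ 7 ≤ l ∧ AdmitsCore P ∧
      CondP2 P l ∧ CondP5 P l ∧ CondP6 P l ∧
      (∀ v ∈ badPlaces P, residueChar P.F v = l → localHeight P v < Real.sqrt (logQForall P)) ∧
      H < logQForall P ∧ Real.sqrt (logQForall P) ≤ l ∧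
      (l : ℝ) ≤ 10 * delta 2 * Real.sqrt (logQForall P) * Real.log (2 * delta 2 * logQForall P) ∧
      Cor22.Display P l η := by
  haveI : IsCyclotomicExtension {4} ℚ (CyclotomicField 4 ℚ) := CyclotomicField.isCyclotomicExtension 4 ℚ
  have hζ := (IsCyclotomicExtension.zeta_spec 4 ℚ (CyclotomicField 4 ℚ)).toInteger_isPrimitiveRoot
  obtain ⟨m₀, hm₀⟩ := exists_display_of_hreg_window_of (CyclotomicField 4 ℚ) hζ hreg hη
  obtain ⟨l, hlp, hl7, hP2, hP5, hP6, hP3, hlo, hhi, hh, hdisp⟩ := hm₀ (max m₀ ⌈H⌉₊) (le_max_left _ _)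
  refine ⟨_, l, mem_UP hζ _, mem_std_empty hζ _, hlp, hl7, admitsCore hζ _, hP2, hP5, hP6, hP3, ?_, hlo, hhi, hdisp⟩
  have h1 : H ≤ ⌈H⌉₊ := Nat.le_ceil _
  have h2 : ((⌈H⌉₊ : ℕ) : ℝ) ≤ ((max m₀ ⌈H⌉₊ : ℕ) : ℝ) := by exact_mod_cast le_max_right _ _
  linarith

/-- **The same from v3's `hvol`** (`Conditional.abc_of_S_v3`, p430884; binder type verbatim): Thm. 1.10's display at window-admissible
split-bad points of unbounded height (abc-iut-s2-p4's `thm110Display_of_hvol_of_splitBadPoint`). Nothing asserted about any point or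
about print; no side taken. [cite: Mochizuki2012, IUTchIV Thm. 1.10 pp. 22–31] [claim: Mochizuki2012, status: disputed] -/
theorem exists_display_of_hvol_window
    (hvol : ∀ P₀ : NFPoint, P₀ ∈ UP → ∀ l : ℕ, l.Prime → 5 ≤ l →
      Cor22.AdmitsCore P₀ → Cor22.CondP2 P₀ l → Cor22.CondP5 P₀ l → Cor22.CondP6 P₀ l →
        Cor22.HullVolumeAtDatum P₀ l (((l : ℝ) + 1) / 4 *
          ((1 + 12 * (Cor22.dmod P₀ : ℝ) / l) * (P₀.logDiff + Cor22.logCondAvoid P₀ {2, l})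
            + 2 * Real.log l + 52
            + 20 / 3 * Real.log (((2 ^ 12 * 3 ^ 3 * 5 * Cor22.dmod P₀ : ℕ) : ℝ) * (l : ℝ))
              * (Nat.primeCounting (2 ^ 12 * 3 ^ 3 * 5 * Cor22.dmod P₀ * l) : ℝ))))
    {η : ℝ} (hη : IsEtaPrm η) (H : ℝ) :
    ∃ (P : NFPoint) (l : ℕ), P ∈ UP ∧ P ∈ (CBData.std ∅ (by simp)).toSet ∧ l.Prime ∧ 7 ≤ l ∧ AdmitsCore P ∧
      CondP2 P l ∧ CondP5 P l ∧ CondP6 P l ∧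
      (∀ v ∈ badPlaces P, residueChar P.F v = l → localHeight P v < Real.sqrt (logQForall P)) ∧
      H < logQForall P ∧ Real.sqrt (logQForall P) ≤ l ∧
      (l : ℝ) ≤ 10 * delta 2 * Real.sqrt (logQForall P) * Real.log (2 * delta 2 * logQForall P) ∧
      Cor22.Display P l η := by
  haveI : IsCyclotomicExtension {4} ℚ (CyclotomicField 4 ℚ) := CyclotomicField.isCyclotomicExtension 4 ℚ
  have hζ := (IsCyclotomicExtension.zeta_spec 4 ℚ (CyclotomicField 4 ℚ)).toInteger_isPrimitiveRoot
  obtain ⟨m₀, hm₀⟩ := SplitBadWindow.exists_admissible_window_of (CyclotomicField 4 ℚ) hζ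
  obtain ⟨l, hlp, hl7, hP2, hP5, hP6, hP3, hlo, hhi, hh⟩ := hm₀ (max m₀ ⌈H⌉₊) (le_max_left _ _)
  refine ⟨_, l, mem_UP hζ _, mem_std_empty hζ _, hlp, hl7, admitsCore hζ _, hP2, hP5, hP6, hP3, ?_, hlo, hhi,
    thm110Display_of_hvol_of_splitBadPoint hvol hη (mem_UP hζ _) hlp (by omega) (admitsCore hζ _) hP2 hP5 hP6
      (fun p _ => sum_indicator_weight_le_half hζ _ {2, l} (by simp) p)⟩
  have h1 : H ≤ ⌈H⌉₊ := Nat.le_ceil _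
  have h2 : ((⌈H⌉₊ : ℕ) : ℝ) ≤ ((max m₀ ⌈H⌉₊ : ℕ) : ℝ) := by exact_mod_cast le_max_right _ _
  linarith

end Conditional

end Summit.ABC.IUTFork

end
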